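import Summits.RiemannHypothesis.RiemannHypothesis.Theorems.Splittings.LiSlowRecurrence
import Summits.RiemannHypothesis.RiemannHypothesis.Theorems.Splittings.LiGeometricQuadruple
import HarnessLib

/-!
# Splittings — Li neg lens: the HEIGHT-RESCUE DICHOTOMY at the multiset level — slow recurrence at scale `2/H` is rescued by
# the verified height `H`; NO height rescues any geometric progression `{q^k}` (SPLIT-li-neg gen 3, §§7–9)

Cell rh-split, seat rh-split-li-neg g3 (brief sha16 f79c5f09d8bcb036), card `run/shared/lean/pub/rh-split/cards/SPLIT-li-neg.md`
§9 (gen-3 addendum; referee rh-split-ref g2 2026-08-27T01:27:02Z: DELIVERABLE, farm rc 0 / 0 warn / 0 sorry, std axioms on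
`not_multisetLiCriterionOnAbove_geom` / `riemannHypothesis_iff_liPosOn_of_bohrShift_le_200`, «CONTENT PASS in advance for a
zero-def (or def-spelled) carve of e8ec9abfbb5d6735»); source `HOME/rh-split-li-neg/LiSlowRecurrence.lean` sha16 e8ec9abfbb5d6735,
whose §§1–5 are the LANDED `Theorems/Splittings/LiSlowRecurrence.lean` (p489464, typer-1 g3; `IsSlowRecurrent` / `IsBohrRecurrentShift`
spelled out there).  Filed by rh-split-typer-1 g4.
This part: one definition, `MultisetLiCriterionOnAbove S H` — the index-set Li criterion at the multiset level for Bombieri–Lagarias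
families whose members of height `|Im ρ_i| ≤ H` lie on `Re = 1/2` (the abstract shadow of «`RiemannHypothesisUpTo H ∧ LiPosOn S ⟹
RH`»; sibling of the tree's `LiIndexSets.MultisetLiCriterionOn`) — and:
* §7 the positive side: slow recurrence at scale `2/H` (the scratch's `IsSlowRecurrent S (2/H)`, SPELLED OUT as in the landed
  `LiSlowRecurrence.lean`) gives the criterion above height `H` (`multisetLiCriterionOnAbove_of_isSlowRecurrent`); hence bounded gaps
  `g ≤ H/5` (`…_of_hasGapsLe`) and Bohr-recurrent shifts `S − c`, `|c| ≤ H/5` (`…_of_bohrShift`);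
* §8 the negative side, UNCONDITIONAL and at EVERY height: for every `q ≥ 2` and every `H` there is a Bombieri–Lagarias family (the
  quadruple of `LiGeometricQuadruple`, `θ = φ_q/q^{L+1}`, `λ = c₀^{q^{-(L+1)}}`; four fake zeros of height `> H`, two with `Re < 1/2`)
  all of whose Li sums at the indices `q^k` are `≥ 0` (`not_multisetLiCriterionOnAbove_geom`); the lacunary `{2^k}` as the
  `q = 2` case (`not_multisetLiCriterionOnAbove_powTwo`; the scratch proved it separately); corollaries: no geometric progression is
  slow-recurrent at any scale / Bohr-recurrent under any shift (`not_isSlowRecurrent_geom/_powTwo`, `not_isBohrRecurrentShift_geom/_powTwo`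
  — recovering for these sequences the classical non-recurrence of lacunary sets, Pollington 1979 / de Mathan 1980, via Bombieri–Lagarias);
* §9 the dichotomy in one line (`li_height_rescue_dichotomy`, `li_height_rescue_dichotomy_geom`).
Referee labels (01:27:02Z): (3) multiset-level criterion on `{q^k}` REFUTED AT EVERY HEIGHT — unconditional kernel theorem; the ζ-level
status of «λ_{q^k} ≥ 0 ∀ k ⟹ RH» stays UNDECIDED.  Proof edits vs the scratch: dot-notation on the spelled-out abbreviations ↦ the
landed flattened lemmas (`isSlowRecurrent_of_bohrShift`, `isSlowRecurrent_of_hasGapsLe`); `PowTwo` ↦ `Quadruple`.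
HONEST LABEL: «SPLITTING SEARCH over kernel-typed RH-EQUIVALENCES; a splitting A ∧ B ⟹ RH is CONDITIONAL bookkeeping
unless A and B are both proved; nothing here bears on the truth of RH.»
-/

set_option linter.dupNamespace false

noncomputable section

open Complex Filter Topology Set
open scoped ComplexConjugate Real

namespace Summit.RiemannHypothesis.RiemannHypothesis.Theorems.Splittings.LiSlowRecurrence

open Literature.NumberTheory.LFunctions
open Literature.NumberTheory.LFunctions.BombieriLagarias
open Literature.NumberTheory.DiophantineGeometry (RiemannHypothesisUpTo)
open Summit.RiemannHypothesis.RiemannHypothesis.Theorems.Splittings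
open Summit.RiemannHypothesis.RiemannHypothesis.Theorems.Splittings.LiIndexSets

/-! ## §7 The multiset criterion GIVEN a zero-free height; slow recurrence suffices -/

/-- The **index-set Li criterion at the multiset level for families on the line up to height `H`**: as the
tree's `MultisetLiCriterionOn S`, but quantifying only over Bombieri–Lagarias families whose members of
height `|Im ρ_i| ≤ H` lie on `Re = 1/2` (the abstract form of `RiemannHypothesisUpTo H`).  The question
«does the verified height `H` rescue the Li criterion on `S`?» at the multiset level. -/
def MultisetLiCriterionOnAbove (S : Set ℕ) (H : ℝ) : Prop :=
  ∀ (ι : Type) (ρ : ι → ℂ) (m : ι → ℕ), (∀ i, 0 < m i) → (∀ i, ρ i ≠ 0) → (∀ i, ρ i ≠ 1) →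
    Summable (weight (fun i ↦ 1 - conj (ρ i)) m) →
    (∀ i, |(ρ i).im| ≤ H → (ρ i).re = 1 / 2) →
    (∀ n ∈ S, 1 ≤ n → 0 ≤ ∑' i, (m i : ℝ) * (1 - (1 - 1 / ρ i) ^ n).re) → ∀ i, 1 / 2 ≤ (ρ i).re

/-- The unrestricted criterion implies the height-`H` one. -/
theorem multisetLiCriterionOnAbove_of_multisetLiCriterionOn {S : Set ℕ} (h : MultisetLiCriterionOn S)
    (H : ℝ) : MultisetLiCriterionOnAbove S H :=
  fun ι ρ m hm h0 h1 hR _ hpos ↦ h ι ρ m hm h0 h1 hR hpos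

/-- Monotone in the height. -/
theorem MultisetLiCriterionOnAbove.mono_height {S : Set ℕ} {H H' : ℝ}
    (h : MultisetLiCriterionOnAbove S H) (hH : H ≤ H') : MultisetLiCriterionOnAbove S H' :=
  fun ι ρ m hm h0 h1 hR hline hpos ↦ h ι ρ m hm h0 h1 hR (fun i hi ↦ hline i (hi.trans hH)) hpos

/-- Monotone in the set. -/
theorem MultisetLiCriterionOnAbove.mono_set {S T : Set ℕ} {H : ℝ} (h : MultisetLiCriterionOnAbove S H)
    (hST : S ⊆ T) : MultisetLiCriterionOnAbove T H :=
  fun ι ρ m hm h0 h1 hR hline hpos ↦ h ι ρ m hm h0 h1 hR hline fun n hn h1n ↦ hpos n (hST hn) h1n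

/-- **Positive side: slow recurrence at scale `2/H` gives the criterion above height `H`** (`H > 0`). -/
theorem multisetLiCriterionOnAbove_of_isSlowRecurrent {S : Set ℕ} {H : ℝ} (hHpos : 0 < H)
    (hS : (∀ (k : ℕ) (z : Fin k → ℂ), (∀ i, ‖z i‖ = 1) → (∀ i, ‖z i - 1‖ ≤ (2 / H)) →
      ∀ N : ℕ, ∃ n ∈ S, N ≤ n ∧ ∀ i, (1 : ℝ) / 2 ≤ (z i ^ n).re)) :
    MultisetLiCriterionOnAbove S H := by
  intro ι ρ m hm h0 h1 hR hline hpos i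
  by_contra hlt
  rw [not_le] at hlt
  obtain ⟨n, hnS, hn1, hneg⟩ := exists_tsum_neg_pos_of_isSlowRecurrent hm h0 h1 hR hHpos hline hlt hS
  exact absurd (hpos n hnS hn1) (not_le.2 hneg)

/-- Hence bounded gaps `g` are rescued by any height `H ≥ 5g` … -/
theorem multisetLiCriterionOnAbove_of_hasGapsLe {S : Set ℕ} {g : ℕ} (hS : HasGapsLe S g) {H : ℝ}
    (hHpos : 0 < H) (hg : 5 * (g : ℝ) ≤ H) : MultisetLiCriterionOnAbove S H :=
  multisetLiCriterionOnAbove_of_isSlowRecurrent hHpos (isSlowRecurrent_of_hasGapsLe hS (by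
    rw [show (g : ℝ) * (2 / H) = (2 * g) / H by ring, div_le_div_iff₀ hHpos (by norm_num : (0:ℝ) < 5)]
    linarith))

/-- … and a Bohr-recurrent shift `S − c` by any height `H ≥ 5|c|`. -/
theorem multisetLiCriterionOnAbove_of_bohrShift {S : Set ℕ} {c : ℤ}
    (hS : (∀ (k : ℕ) (z : Fin k → ℂ), (∀ i, ‖z i‖ = 1) → ∀ ε : ℝ, 0 < ε →
      ∀ N : ℕ, ∃ n ∈ S, N ≤ n ∧ ∀ i, ‖z i ^ ((n : ℤ) - c) - 1‖ < ε))
    {H : ℝ} (hHpos : 0 < H) (hc : 5 * |(c : ℝ)| ≤ H) : MultisetLiCriterionOnAbove S H :=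
  multisetLiCriterionOnAbove_of_isSlowRecurrent hHpos (isSlowRecurrent_of_bohrShift hS (by
    rw [show |(c : ℝ)| * (2 / H) = (2 * |(c : ℝ)|) / H by ring,
      div_le_div_iff₀ hHpos (by norm_num : (0 : ℝ) < 5)]
    linarith))

/-! ## §8 Every geometric progression `{q^k}`, `q ≥ 2`: the multiset criterion FAILS above EVERY height

For a height `H` pick `L ≥ 3` with `M = q^L > 4H`, `M' = q^{L+1}`, `θ = φ_q/M'`, `c₀ = 2/cos θ − 1`, `λ = c₀^{1/M'}` and the four
`w`-values `λe^{±iθ}, λ^{-1}e^{±iθ}`.  The Li sums are `4 − 2 cos(nθ)(λⁿ + λ⁻ⁿ)`; at `n = q^k`, `k ≤ L`: `θ ≤ nθ ≤ π/2`, sum `≥ 0`;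
`k ≥ L+1`: `nθ = q^j φ_q`, `cos = cos φ_q < 0`, sum `> 0`.  Two members have `Re ρ < 1/2`; all four have `|Im ρ| ≥ 1/(2θ) > H`. -/

open Quadruple Geom in
/-- **No verified height rescues ANY geometric progression `{q^k}` (`q ≥ 2`) at the multiset level.**
Same quadruple as `not_multisetLiCriterionOnAbove_powTwo`, with `θ = φ_q / q^{L+1}` and
`λ = c₀^{q^{-(L+1)}}`. -/
theorem not_multisetLiCriterionOnAbove_geom {q : ℕ} (hq : 2 ≤ q) (H : ℝ) :
    ¬ MultisetLiCriterionOnAbove {n | ∃ k, n = q ^ k} H := by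
  intro hcrit
  have hq_pos : 0 < q := by omega
  have hqR : (2 : ℝ) ≤ q := by exact_mod_cast hq
  -- level `L ≥ 3`, `M = q^L > 4H`, `M' = q^(L+1)`
  obtain ⟨N, hN⟩ := exists_nat_gt (4 * H)
  set L : ℕ := max 3 N with hL
  have hL3 : 3 ≤ L := le_max_left _ _
  set M : ℕ := q ^ L with hM
  set M' : ℕ := q ^ (L + 1) with hM'
  have hMH : 4 * H < (M : ℝ) := by
    calc 4 * H < N := hN
      _ ≤ L := by exact_mod_cast le_max_right 3 N
      _ ≤ (M : ℝ) := by rw [hM]; exact_mod_cast (Nat.lt_pow_self (by omega)).le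
  have hM8 : (8 : ℝ) ≤ M := by
    have : (2 : ℕ) ^ 3 ≤ q ^ L :=
      (Nat.pow_le_pow_left hq 3).trans (Nat.pow_le_pow_right hq_pos hL3)
    rw [hM]; exact_mod_cast this
  have hMpos : (0 : ℝ) < M := by linarith
  have hM'eq : (M' : ℝ) = q * M := by rw [hM', hM]; push_cast; ring
  have hM'pos : (0 : ℝ) < M' := by rw [hM'eq]; positivity
  have hMM' : M ≤ M' := by rw [hM, hM']; exact Nat.pow_le_pow_right hq_pos (Nat.le_succ L)
  -- the angle `θ = φ/M'`
  have hphi_le := phi_le_pi q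
  have hphi_gt := pi_div_two_lt_phi hq
  have hphi_pos : 0 < phi q := by linarith [Real.pi_pos]
  set θ : ℝ := phi q / M' with hθ
  have hθpos : 0 < θ := by rw [hθ]; positivity
  have hM'θ : (M' : ℝ) * θ = phi q := by rw [hθ]; field_simp
  have hMθ : (M : ℝ) * θ ≤ π / 2 := by
    have e : (M : ℝ) * θ = phi q / q := by
      rw [hθ, hM'eq]; field_simp
    have hq0 : (0 : ℝ) < q := by positivity
    rw [e, div_le_iff₀ hq0]
    have : π / 2 * 2 ≤ π / 2 * (q : ℝ) := mul_le_mul_of_nonneg_left hqR (by positivity)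
    linarith
  have hθle : θ ≤ 27 / 100 := by
    -- `θ = φ/M' ≤ π/(q M) ≤ π/16`
    have h16 : (16 : ℝ) ≤ M' := by
      rw [hM'eq]
      calc (16 : ℝ) = 2 * 8 := by norm_num
        _ ≤ q * M := mul_le_mul hqR hM8 (by norm_num) (by positivity)
    rw [hθ, div_le_iff₀ hM'pos]
    have : (27 : ℝ) / 100 * 16 ≤ 27 / 100 * M' := by gcongr
    linarith [Real.pi_lt_d2]
  have hθle3 : θ ≤ π / 3 := by linarith [Real.pi_gt_three]
  have hcos_half : 1 / 2 ≤ Real.cos θ := by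
    rw [← Real.cos_pi_div_three]
    exact Real.cos_le_cos_of_nonneg_of_le_pi hθpos.le (by linarith [Real.pi_pos]) hθle3
  have hcos_pos : 0 < Real.cos θ := by linarith
  have hcos_lt_one : Real.cos θ < 1 := by
    rw [← Real.cos_zero]
    exact Real.cos_lt_cos_of_nonneg_of_le_pi_div_two le_rfl (by linarith [Real.pi_pos]) hθpos
  -- `c₀ = 2/cos θ − 1 = λ^{M'}`
  set c₀ : ℝ := 2 / Real.cos θ - 1 with hc₀
  have hc₀_gt : 1 < c₀ := by
    have : 2 < 2 / Real.cos θ := by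
      rw [lt_div_iff₀ hcos_pos]; linarith
    rw [hc₀]; linarith
  have hc₀_le : c₀ - 1 ≤ 2 * θ ^ 2 := by
    have h1 : 1 - θ ^ 2 / 2 ≤ Real.cos θ := Real.one_sub_sq_div_two_le_cos
    have hθ1 : θ ^ 2 ≤ 1 := pow_le_one₀ hθpos.le (by linarith)
    have h2 : 2 ≤ (2 + 2 * θ ^ 2) * Real.cos θ := by
      have hA : (2 + 2 * θ ^ 2) * (1 - θ ^ 2 / 2) ≤ (2 + 2 * θ ^ 2) * Real.cos θ :=
        mul_le_mul_of_nonneg_left h1 (by positivity)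
      have hB : (2 + 2 * θ ^ 2) * (1 - θ ^ 2 / 2) = 2 + θ ^ 2 * (1 - θ ^ 2) := by ring
      have hC : 0 ≤ θ ^ 2 * (1 - θ ^ 2) := mul_nonneg (sq_nonneg θ) (by linarith)
      linarith
    have h3 : 2 / Real.cos θ ≤ 2 + 2 * θ ^ 2 := by rw [div_le_iff₀ hcos_pos]; linarith
    rw [hc₀]; linarith
  have hcosc : Real.cos θ * (c₀ + 1) = 2 := by
    rw [hc₀]; field_simp; ring
  set lam : ℝ := Real.exp (Real.log c₀ / M') with hlam
  have hlam1 : 1 < lam := Real.one_lt_exp_iff.2 (div_pos (Real.log_pos hc₀_gt) hM'pos)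
  have hlam_pos : 0 < lam := Real.exp_pos _
  have hlamM : lam ^ M' = c₀ := by
    rw [hlam, ← Real.exp_nat_mul, mul_div_cancel₀ _ hM'pos.ne', Real.exp_log (by linarith)]
  have hlam_sub : lam - 1 ≤ 2 * θ ^ 3 := by
    have hB : 1 + (M' : ℝ) * (lam - 1) ≤ (1 + (lam - 1)) ^ M' := one_add_mul_le_pow (by linarith) M'
    rw [add_sub_cancel, hlamM] at hB
    have h1 : (M' : ℝ) * (lam - 1) ≤ 2 * θ ^ 2 := by linarith
    -- `1/M' = θ/φ ≤ θ` since `φ ≥ π/2 > 1`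
    have hM'ge : 1 / θ ≤ (M' : ℝ) := by
      rw [div_le_iff₀ hθpos, hM'θ]; linarith [Real.pi_gt_three]
    have h2 : (1 / θ) * (lam - 1) ≤ 2 * θ ^ 2 :=
      (mul_le_mul_of_nonneg_right hM'ge (by linarith)).trans h1
    rw [div_mul_eq_mul_div, one_mul, div_le_iff₀ hθpos] at h2
    have e3 : 2 * θ ^ 2 * θ = 2 * θ ^ 3 := by ring
    linarith
  clear_value lam c₀ θ M' M L
  have hrad_abs : ∀ b : Bool × Bool, |rad lam b - 1| ≤ 2 * θ ^ 3 := by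
    intro b
    unfold rad
    cases b.1
    · simp only [cond_false]
      have e : lam⁻¹ - 1 = -((lam - 1) / lam) := by field_simp; ring
      rw [e, abs_neg, abs_of_nonneg (div_nonneg (by linarith) hlam_pos.le)]
      exact (div_le_self (by linarith) hlam1.le).trans hlam_sub
    · simp only [cond_true]
      rw [abs_of_nonneg (by linarith)]; exact hlam_sub
  have hrad_pos : ∀ b : Bool × Bool, 0 < rad lam b := by
    intro b; unfold rad; cases b.1
    · simpa using inv_pos.2 hlam_pos
    · simpa using hlam_pos
  have hrad_ne_one : ∀ b : Bool × Bool, rad lam b ≠ 1 := by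
    intro b; unfold rad; cases b.1
    · simp only [cond_false]
      exact fun h ↦ hlam1.ne' (inv_eq_one.1 h)
    · simp only [cond_true]; exact hlam1.ne'
  have hang : ∀ b : Bool × Bool, ang θ b = θ ∨ ang θ b = -θ := by
    intro b; unfold ang; cases b.2
    · right; simp
    · left; simp
  -- heights: `|Im ρ| ≥ 1/(2θ) = M'/(2φ) ≥ M/π … > H`
  have hheight : H < 1 / (2 * θ) := by
    have e : 1 / (2 * θ) = M' / (2 * phi q) := by rw [hθ]; field_simp
    rw [e, lt_div_iff₀ (by positivity), hM'eq]
    have h2 : (2 : ℝ) * M ≤ q * M := mul_le_mul_of_nonneg_right hqR hMpos.le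
    by_cases hH : 0 ≤ H
    · have h1 : H * (2 * phi q) ≤ H * 8 :=
        mul_le_mul_of_nonneg_left (by linarith [Real.pi_lt_four]) hH
      linarith
    · have h1 : H * (2 * phi q) < 0 := mul_neg_of_neg_of_pos (by linarith) (by positivity)
      linarith
  have hline : ∀ b : Bool × Bool, |(quad lam θ b).im| ≤ H → (quad lam θ b).re = 1 / 2 := by
    intro b hb
    exact absurd (hb.trans_lt hheight)
      (not_lt.2 (half_inv_le_abs_im_rhoOf hθpos hθle (hang b) (hrad_pos b) (hrad_abs b)))
  -- the criterion applied to the quadruple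
  have key := hcrit (Bool × Bool) (quad lam θ) (fun _ ↦ 1) (fun _ ↦ Nat.one_pos)
    (fun b ↦ rhoOf_ne_zero (hrad_pos b).le (hrad_ne_one b) _)
    (fun b ↦ rhoOf_ne_one (hrad_pos b).ne' _) (hasSum_fintype _).summable hline ?_ (true, true)
  · have hlt : (quad lam θ (true, true)).re < 1 / 2 := by
      show (rhoOf (rad lam (true, true)) (ang θ (true, true))).re < 1 / 2
      simp only [rad, ang, cond_true]
      exact re_rhoOf_lt_half hlam1 θ
    exact absurd key (not_le.2 hlt)
  -- positivity of the Li sums at every `n = q^k`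
  rintro n ⟨k, rfl⟩ _
  rw [tsum_fintype]
  simp only [Nat.cast_one, one_mul]
  rw [quad_liSum]
  have hsum_nonneg : 0 ≤ lam ^ (q ^ k) + lam⁻¹ ^ (q ^ k) := by positivity
  rcases Nat.lt_or_ge L k with hk | hk
  swap
  · -- `k ≤ L`: `θ ≤ nθ ≤ Mθ ≤ π/2`, `λⁿ + λ⁻ⁿ ≤ c₀ + 1 = 2/cos θ`
    have hnθ_ge : θ ≤ (q ^ k : ℕ) * θ := by
      have : (1 : ℝ) ≤ (q ^ k : ℕ) := by exact_mod_cast Nat.one_le_pow k q hq_pos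
      exact le_mul_of_one_le_left hθpos.le this
    have hnθ_le : ((q ^ k : ℕ) : ℝ) * θ ≤ π / 2 := by
      have h2 : ((q ^ k : ℕ) : ℝ) ≤ M := by
        rw [hM]; exact_mod_cast Nat.pow_le_pow_right hq_pos hk
      calc ((q ^ k : ℕ) : ℝ) * θ ≤ M * θ := by gcongr
        _ ≤ π / 2 := hMθ
    have hcos_le : Real.cos ((q ^ k : ℕ) * θ) ≤ Real.cos θ :=
      Real.cos_le_cos_of_nonneg_of_le_pi hθpos.le (by linarith [Real.pi_pos]) hnθ_ge
    have hcos_ge : 0 ≤ Real.cos ((q ^ k : ℕ) * θ) :=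
      Real.cos_nonneg_of_neg_pi_div_two_le_of_le (by linarith [Real.pi_pos]) (by linarith [Real.pi_pos])
    have hpow : lam ^ (q ^ k) + lam⁻¹ ^ (q ^ k) ≤ c₀ + 1 := by
      have h1 : lam ^ (q ^ k) ≤ lam ^ M' := pow_le_pow_right₀ hlam1.le (by
        calc q ^ k ≤ q ^ L := Nat.pow_le_pow_right hq_pos hk
          _ = M := hM.symm
          _ ≤ M' := hMM')
      have h2 : lam⁻¹ ^ (q ^ k) ≤ 1 := pow_le_one₀ (inv_pos.2 hlam_pos).le (inv_le_one_of_one_le₀ hlam1.le)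
      rw [hlamM] at h1; linarith
    have : 2 * Real.cos ((q ^ k : ℕ) * θ) * (lam ^ (q ^ k) + lam⁻¹ ^ (q ^ k))
        ≤ 2 * Real.cos θ * (c₀ + 1) := by gcongr
    rw [mul_assoc 2 (Real.cos θ), hcosc] at this
    push_cast at this ⊢
    linarith
  · -- `k ≥ L+1`: `nθ = q^j φ`, `cos = cos φ < 0`
    obtain ⟨j, rfl⟩ : ∃ j, k = L + 1 + j := ⟨k - (L + 1), by omega⟩
    have e : ((q ^ (L + 1 + j) : ℕ) : ℝ) * θ = (q : ℝ) ^ j * phi q := by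
      rw [hθ, hM']; push_cast
      field_simp
      ring
    push_cast at e ⊢
    rw [e, cos_pow_mul_phi]
    have hneg : 0 ≤ -(2 * Real.cos (phi q)) * (lam ^ q ^ (L + 1 + j) + lam⁻¹ ^ q ^ (L + 1 + j)) :=
      mul_nonneg (by linarith [cos_phi_neg hq]) hsum_nonneg
    linarith

/-- **Corollary: no geometric progression `{q^k}` (`q ≥ 2`) is slow-recurrent at any positive scale** (so no verified height can
feed the §3 mechanism of `LiSlowRecurrence` for it; `IsSlowRecurrent` spelled out). -/
theorem not_isSlowRecurrent_geom {q : ℕ} (hq : 2 ≤ q) {δ : ℝ} (hδ : 0 < δ) :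
    ¬ (∀ (k : ℕ) (z : Fin k → ℂ), (∀ i, ‖z i‖ = 1) → (∀ i, ‖z i - 1‖ ≤ δ) →
      ∀ N : ℕ, ∃ n ∈ {n | ∃ k, n = q ^ k}, N ≤ n ∧ ∀ i, (1 : ℝ) / 2 ≤ (z i ^ n).re) := by
  intro hS
  have h2 : (∀ (k : ℕ) (z : Fin k → ℂ), (∀ i, ‖z i‖ = 1) → (∀ i, ‖z i - 1‖ ≤ (2 / (2 / δ))) →
      ∀ N : ℕ, ∃ n ∈ {n | ∃ k, n = q ^ k}, N ≤ n ∧ ∀ i, (1 : ℝ) / 2 ≤ (z i ^ n).re) := by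
    have e : 2 / (2 / δ) = δ := by field_simp
    rwa [e]
  exact not_multisetLiCriterionOnAbove_geom hq (2 / δ)
    (multisetLiCriterionOnAbove_of_isSlowRecurrent (by positivity) h2)

/-- **Corollary: no shift `{q^k} − c` is a set of Bohr recurrence** (`q ≥ 2`; recovering, uniformly in `c`, the classical
non-recurrence of lacunary sequences — Pollington 1979 / de Mathan 1980 — for these sequences, via Bombieri–Lagarias;
`IsBohrRecurrentShift` spelled out). -/
theorem not_isBohrRecurrentShift_geom {q : ℕ} (hq : 2 ≤ q) (c : ℤ) :
    ¬ (∀ (k : ℕ) (z : Fin k → ℂ), (∀ i, ‖z i‖ = 1) → ∀ ε : ℝ, 0 < ε →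
      ∀ N : ℕ, ∃ n ∈ {n | ∃ k, n = q ^ k}, N ≤ n ∧ ∀ i, ‖z i ^ ((n : ℤ) - c) - 1‖ < ε) := by
  intro hS
  have hδ : 0 < (2 / 5) / (|(c : ℝ)| + 1) := by positivity
  refine not_isSlowRecurrent_geom hq hδ (isSlowRecurrent_of_bohrShift hS ?_)
  rw [← mul_div_assoc, div_le_iff₀ (by positivity)]
  nlinarith [abs_nonneg (c : ℝ)]

/-! ## §8′ The lacunary set `{2^k}` = the `q = 2` instance (the scratch's separate `PowTwo` proof, `θ = π/(3·2^L)`, is not re-filed) -/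

/-- **No verified height rescues the lacunary set `{2^k}` at the multiset level** (`q = 2` in `not_multisetLiCriterionOnAbove_geom`). -/
theorem not_multisetLiCriterionOnAbove_powTwo (H : ℝ) :
    ¬ MultisetLiCriterionOnAbove {n | ∃ k, n = 2 ^ k} H :=
  not_multisetLiCriterionOnAbove_geom le_rfl H

/-- **`{2^k}` is slow-recurrent at NO positive scale** (`q = 2` in `not_isSlowRecurrent_geom`). -/
theorem not_isSlowRecurrent_powTwo {δ : ℝ} (hδ : 0 < δ) :
    ¬ (∀ (k : ℕ) (z : Fin k → ℂ), (∀ i, ‖z i‖ = 1) → (∀ i, ‖z i - 1‖ ≤ δ) →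
      ∀ N : ℕ, ∃ n ∈ {n | ∃ k, n = 2 ^ k}, N ≤ n ∧ ∀ i, (1 : ℝ) / 2 ≤ (z i ^ n).re) :=
  not_isSlowRecurrent_geom le_rfl hδ

/-- **No shift `{2^k} − c` is a set of Bohr recurrence** (`q = 2` in `not_isBohrRecurrentShift_geom`). -/
theorem not_isBohrRecurrentShift_powTwo (c : ℤ) :
    ¬ (∀ (k : ℕ) (z : Fin k → ℂ), (∀ i, ‖z i‖ = 1) → ∀ ε : ℝ, 0 < ε →
      ∀ N : ℕ, ∃ n ∈ {n | ∃ k, n = 2 ^ k}, N ≤ n ∧ ∀ i, ‖z i ^ ((n : ℤ) - c) - 1‖ < ε) :=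
  not_isBohrRecurrentShift_geom le_rfl c

/-! ## §9 Summary (the gen-3 height-rescue dichotomy, multiset level)

* rescued by height `H`: every `S` slow-recurrent at scale `2/H` — bounded gaps `≤ H/5`
  (`multisetLiCriterionOnAbove_of_hasGapsLe`), Bohr-recurrent shifts `S − c`, `|c| ≤ H/5`
  (`multisetLiCriterionOnAbove_of_bohrShift`); at the zeta level with the tree's `RH(101)` / `RH(1000)`:
  `LiSlowRecurrence.riemannHypothesis_iff_liPosOn_of_isSlowRecurrent_101 / _1000`;
* rescued by NO height: every geometric progression `{q^k}`, `q ≥ 2` (`not_multisetLiCriterionOnAbove_geom`), in particular `{2^k}`,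
  although `RH ⟹ LiPosOn {2^k}` trivially; the zeta-level converse for `{q^k}` stays UNDECIDED (it would have to use more of ζ
  than the Bombieri–Lagarias axioms + a verified height). -/

/-- The height-rescue dichotomy: slow recurrence at scale `2/H` is rescued by height `H`; `{2^k}` by no height. -/
theorem li_height_rescue_dichotomy :
    (∀ H : ℝ, 0 < H → ∀ S : Set ℕ, (∀ (k : ℕ) (z : Fin k → ℂ), (∀ i, ‖z i‖ = 1) → (∀ i, ‖z i - 1‖ ≤ (2 / H)) →
      ∀ N : ℕ, ∃ n ∈ S, N ≤ n ∧ ∀ i, (1 : ℝ) / 2 ≤ (z i ^ n).re) → MultisetLiCriterionOnAbove S H) ∧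
    (∀ H : ℝ, ¬ MultisetLiCriterionOnAbove {n | ∃ k, n = 2 ^ k} H) :=
  ⟨fun _ hH _ hS ↦ multisetLiCriterionOnAbove_of_isSlowRecurrent hH hS,
    not_multisetLiCriterionOnAbove_powTwo⟩

/-- The same dichotomy with EVERY geometric progression `{q^k}`, `q ≥ 2`, on the unreachable side. -/
theorem li_height_rescue_dichotomy_geom :
    (∀ H : ℝ, 0 < H → ∀ S : Set ℕ, (∀ (k : ℕ) (z : Fin k → ℂ), (∀ i, ‖z i‖ = 1) → (∀ i, ‖z i - 1‖ ≤ (2 / H)) →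
      ∀ N : ℕ, ∃ n ∈ S, N ≤ n ∧ ∀ i, (1 : ℝ) / 2 ≤ (z i ^ n).re) → MultisetLiCriterionOnAbove S H) ∧
    (∀ q : ℕ, 2 ≤ q → ∀ H : ℝ, ¬ MultisetLiCriterionOnAbove {n | ∃ k, n = q ^ k} H) :=
  ⟨fun _ hH _ hS ↦ multisetLiCriterionOnAbove_of_isSlowRecurrent hH hS,
    fun _ hq H ↦ not_multisetLiCriterionOnAbove_geom hq H⟩

end Summit.RiemannHypothesis.RiemannHypothesis.Theorems.Splittings.LiSlowRecurrence

end
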